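import Literature.AlgebraicGeometry.HodgeTheory.RibetTotallyRealHodgeClasses
import HarnessLib

/-!
# Hodge classes on the powers of an abelian variety with a totally real maximal commutative subfield of odd half-rank in its endomorphism algebra: `B•(Aᵏ) = D•(Aᵏ)` (V. K. Murty 1988, Thm. 2)

Family `hodge`, layer `Literature/AlgebraicGeometry/HodgeTheory`. Written for the cell `pub-hodge-ring2`
(seat `atlas-2`, generation 18), companion of `RibetTotallyRealHodgeClasses` (Ribet 1983 Thm. 1: the case
`End⁰(A)` ITSELF a totally real field), which it generalises (§3, PROVED). HONEST FRAMING: research route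
conditional on HC_CM; not a corollary; Q11.4-sentence-2 already refuted in dim ≥ 3. Nothing in this file
uses HC_CM: it vendors ONE theorem in print as a named fact (D-0014) and derives UNCONDITIONAL cases of the
Hodge property `HodgeConjectureFor` from it (the "known in print" column of the cell's atlas, rows `g = 6`
of Albert type II(1) and II(3): simple sixfolds whose endomorphism algebra is an indefinite quaternion algebra
over `ℚ`, resp. a totally indefinite quaternion algebra over a totally real cubic field — the summit-side rows
live in `Summits/HodgeConjecture/HodgeConjecture/Theorems/Ring2AtlasTypeIIRows`).

THE THEOREM IN PRINT (V. Kumar Murty, Proc. Amer. Math. Soc. 104 (1988) 61–68, Thm. 2, p. 67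
[corpus:paper:doi-10-1090-s0002-9939-1988-0958044-1 p0007 L5–8]): "THEOREM 2. Suppose that `E` is a product of
totally real fields and that `V` is free over `E` of rank `2m`, `m` odd. Then `Hod(A) = L(A)`. In particular,
`𝓑(Aᵏ) = 𝓓(Aᵏ)` for all `k ≥ 1`." Standing notation (§2 p. 62 L71–72 and §3 p. 64 L81–84): `A` is an abelian
variety defined over `ℂ` (§1 p. 61), `Δ(A) = End(A) ⊗_ℤ ℚ`, `E` is a maximal commutative semisimple subalgebra of
`Δ(A)`, `V = H₁(A(ℂ), ℚ)`, `𝓑(A)` the Hodge ring `⊕ₚ (H²ᵖ(A(ℂ),ℚ) ∩ Hᵖᵖ)`, `𝓓(A)` its subring generated by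
`H²(A(ℂ),ℚ) ∩ H¹¹`, `Hod(A)` Mumford's Hodge group, `L(A)` the Lefschetz group. Context (p. 66 L80–83): "The next
theorem is a slight generalization of a result of Tankeev [11] who proved it in the case `Δ(A) = E`. The case
`m = 1` is a special case of [5, Theorem 4.1]." (`Δ(A) = E` totally real with `d/e` odd is Ribet 1983 Thm. 1,
the tree's `Ribet1983_hodgeClasses_divisorial_powers_totallyRealField_oddRelDim`; §3 below derives that fact
from this one.) `A` is NOT assumed simple in Thm. 2 (the Proposition of §1 is the simple odd-dimensional case).

RENDERING (the case `E` a FIELD, which is the case of every simple `A` — p. 67 L70–71: "As `A` is simple, any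
maximal commutative semisimple subalgebra of `Δ(A)` must in fact be a field" — and the only case used by the
cell). `E ≅ K` is given as an abstract number field `K` (Mathlib `NumberField K`, "totally real" =
`NumberField.IsTotallyReal K`) with a ring homomorphism `φ : K →+* A.endAlgebra` (`A.endAlgebra = End⁰(A) =
End(A) ⊗ ℚ`; a ring map between `ℚ`-algebras is `ℚ`-linear, and it is injective as soon as `A ≠ 0`, which the
rank hypothesis with `m` odd forces), exactly as the tree types field actions in
`ComplexMultiplication.CMFieldActionHOne`. "`φ(K)` is a MAXIMAL commutative semisimple subalgebra" is rendered as
"`φ(K)` is its own commutant": every `x ∈ End⁰(A)` commuting with `φ(K)` lies in `φ(K)`. For a subfield the two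
are equivalent: a self-commutant subfield is maximal among commutative (a fortiori commutative semisimple)
subalgebras, since any commutative subalgebra containing `φ(K)` commutes with it; conversely the commutant `C` of a
maximal commutative semisimple subfield `φ(K)` of the semisimple algebra `End⁰(A)` is semisimple with `φ(K)`
central in it, and a semisimple algebra strictly larger than a central subfield contains a strictly larger
commutative semisimple subalgebra (a maximal subfield of a division algebra component, or the diagonal étale
subalgebra of a matrix component), so `C = φ(K)`. Hence the rendered hypothesis is the printed one, neither weaker
nor stronger. "`V` free over `E` of rank `2m`": `V = H₁(A(ℂ),ℚ)` is a `K`-vector space of `ℚ`-dimension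
`2 dim A`, so its `K`-rank is `2 dim A/[K:ℚ]`; rendered `A.dim = [K:ℚ]·m` (`Module.finrank ℚ K * m`) with `Odd m`.
The conclusion `𝓑(Aᵏ) = 𝓓(Aᵏ)` for all `k ≥ 1` is read, as in every `B = D` fact of the tree
(`IsDivisorGenerated`), on rational classes with `ℂ`-coefficients: every rational class of Hodge type `(p,p)` in
`H²ᵖ(A^{N+1}(ℂ); ℂ)` (`A^{N+1} = A.powSucc N`) lies in `divisorClassesSpan = 𝓓ᵖ ⊗ ℂ`. The clause `Hod(A) = L(A)`
is not rendered (no Hodge-group semantics on the carriers).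

CONTENTS. §1 the named fact `Murty1988_hodgeClasses_divisorial_powers_totallyRealMaxSubfield_oddHalfRank`.
§2 PROVED consequences (the fact a hypothesis `h`): `B = D` on every power
(`isDivisorGenerated_powSucc_of_murty1988`), the Hodge property of every power
(`hodgeConjectureFor_powSucc_of_murty1988`, via the tree's unconditional `hodgeConjectureFor_of_isDivisorGenerated`)
and of `A` itself. §3 PROVED: the fact implies Ribet's totally-real fact
(`ribet1983_totallyReal_of_murty1988`: take `K = End⁰(A)` itself, which is trivially its own commutant) — the
print remark p. 66 L80–81, and the tree-internal check that the new rendering specialises correctly. §4 the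
HYPOTHESIS AS A PREDICATE (definitions, nothing asserted): `IsMurtyTypeWith A K φ m` (the packet: `K` totally real,
`φ` self-commutant, `dim A = [K:ℚ]·m`, `m` odd), `HasTotallyRealOddMaxSubfield A` (such a packet exists), the packet
for `K = End⁰(A)` itself (`isMurtyTypeWith_endField`), and the §2 consequences restated on the packet / predicate
(`hodgeConjectureFor_powSucc_of_isMurtyTypeWith`, `…_of_hasTotallyRealOddMaxSubfield`) — the currency of the
summit-side rows.

WHAT THIS DOES NOT SAY. Which abelian varieties carry such a `K` is not decided here: e.g. that every simple
complex abelian sixfold of type II(1) (resp. II(3)) contains a real quadratic (resp. totally real sextic) maximal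
subfield of `End⁰(A)` is quaternion-algebra arithmetic (a quadratic extension of the centre embeds iff it is
inert or ramified at every ramified place; an indefinite algebra imposes no condition at infinity) and is recorded
as prose by the summit-side file, not as a tree theorem; a type-III algebra (`D ⊗ ℝ = ℍ`) has no totally real
maximal subfield, consistently with Murty's exceptional classes in type III.

References.
* [Murty1988] V. Kumar Murty, The Hodge group of an abelian variety, Proc. Amer. Math. Soc. 104 (1988) 61–68,
  Thm. 2 (doi:10.1090/s0002-9939-1988-0958044-1; held, lit key `paper:doi-10-1090-s0002-9939-1988-0958044-1`).
* [Ribet1983] K. A. Ribet, Hodge classes on certain types of abelian varieties, Amer. J. Math. 105 (1983)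
  523–538, Thms. 0 and 1.
* [Murty1984] V. Kumar Murty, Exceptional Hodge classes on certain abelian varieties, Math. Ann. 268 (1984)
  197–206, Thm. 3.1 (`Hod = L` and no type-III factor ⟹ `𝓑(Aᵏ) = 𝓓(Aᵏ)`; Murty's ref. [6]).
* [vanGeemen1994HodgeAV] B. van Geemen, An introduction to the Hodge conjecture for abelian varieties, LNM 1594
  (1994) 233–252, §2.4–2.5 (`B`, `D`).
* [Deligne2000] P. Deligne, The Hodge conjecture (Clay problem statement), §1.
-/

noncomputable section

open CategoryTheory
open Literature.AlgebraicTopology.SingularHomology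
open Literature.AlgebraicGeometry.Motives
open Literature.AlgebraicGeometry.ComplexMultiplication (EndField)
open Literature.Barriers.HodgeConjecture

namespace Literature.AlgebraicGeometry.HodgeTheory

section HodgeTheory

/-! ### §1 The named fact -/

/-- **V. K. Murty 1988, Thm. 2 (the case of a maximal commutative SUBFIELD): on every power of a complex abelian
variety `A` whose endomorphism algebra `End⁰(A)` contains a totally real number field `K` as a self-commutant
subalgebra with `dim A = [K:ℚ]·m`, `m` odd, the Hodge classes are polynomials in divisor classes.** Verbatim:
"Suppose that `E` is a product of totally real fields and that `V` is free over `E` of rank `2m`, `m` odd. Then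
`Hod(A) = L(A)`. In particular, `𝓑(Aᵏ) = 𝓓(Aᵏ)` for all `k ≥ 1`" (`E` a maximal commutative semisimple subalgebra
of `End(A) ⊗ ℚ`, `V = H₁(A(ℂ),ℚ)`). Rendering (module docstring): `K` a number field with
`NumberField.IsTotallyReal K`, `φ : K →+* A.endAlgebra`, self-commutant
(`∀ x, (∀ y, Commute x (φ y)) → x ∈ Set.range φ`), `A.dim = finrank_ℚ K · m`, `Odd m`; conclusion: for every
`N p` every RATIONAL class of Hodge type `(p,p)` in `H²ᵖ(A^{N+1}(ℂ); ℂ)` lies in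
`divisorClassesSpan (A.powSucc N).X (A.powSucc N).dim p` (`= 𝓓ᵖ(A^{N+1}) ⊗ ℂ`). The clause `Hod(A) = L(A)` is not
rendered. Users take `(h : Murty1988_hodgeClasses_divisorial_powers_totallyRealMaxSubfield_oddHalfRank)`. Named
fact (D-0014), a published theorem about Hodge structures, not proved in the tree.
[cite: Murty1988, Thm. 2 (p. 67)] -/
def Murty1988_hodgeClasses_divisorial_powers_totallyRealMaxSubfield_oddHalfRank : Prop :=
  ∀ (A : AbelianVariety ℂ) (K : Type) [Field K] [NumberField K], NumberField.IsTotallyReal K →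
    ∀ φ : K →+* A.endAlgebra, (∀ x : A.endAlgebra, (∀ y : K, Commute x (φ y)) → x ∈ Set.range φ) →
    ∀ m : ℕ, A.dim = Module.finrank ℚ K * m → Odd m →
    ∀ (N p : ℕ) (c : complexBetti (A.powSucc N).X (2 * p)), IsRationalClass c →
      IsOfHodgeType (A.powSucc N).dim (A.powSucc N).X (2 * p) p p c →
        c ∈ divisorClassesSpan (A.powSucc N).X (A.powSucc N).dim p

/-! ### §2 Consequences: `B = D` and the Hodge property on every power -/

variable {K : Type} [Field K] [NumberField K]

/-- **`B(A^{N+1}) = D(A^{N+1})` when `End⁰(A)` has a totally real self-commutant subfield of odd half-rank**, in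
the spelling `IsDivisorGenerated` of `HodgeGroupProductCMFactorClasses`, modulo the fact.
[cite: Murty1988, Thm. 2 (p. 67)] -/
theorem isDivisorGenerated_powSucc_of_murty1988
    (h : Murty1988_hodgeClasses_divisorial_powers_totallyRealMaxSubfield_oddHalfRank)
    (A : AbelianVariety ℂ) (hK : NumberField.IsTotallyReal K) (φ : K →+* A.endAlgebra)
    (hφ : ∀ x : A.endAlgebra, (∀ y : K, Commute x (φ y)) → x ∈ Set.range φ)
    {m : ℕ} (hm : A.dim = Module.finrank ℚ K * m) (hodd : Odd m) (N : ℕ) :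
    IsDivisorGenerated (A.powSucc N) :=
  fun p c hc hpp ↦ h A K hK φ hφ m hm hodd N p c hc hpp

/-- **The Hodge property of every power `A^{N+1}`** under Murty's hypothesis, modulo the fact: `B = D` (the
fact) and `D ⊗ ℂ ⊆` algebraic classes unconditionally (the tree's `hodgeConjectureFor_of_isDivisorGenerated`;
Murty's Remark 1, p. 62: "the condition `𝓑(A) = 𝓓(A)` implies that the Hodge conjecture holds for `A`").
[cite: Murty1988, Thm. 2 and §1 Remark 1] [cite: vanGeemen1994HodgeAV, §2.4] [cite: Deligne2000, §1] -/
theorem hodgeConjectureFor_powSucc_of_murty1988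
    (h : Murty1988_hodgeClasses_divisorial_powers_totallyRealMaxSubfield_oddHalfRank)
    (A : AbelianVariety ℂ) (hK : NumberField.IsTotallyReal K) (φ : K →+* A.endAlgebra)
    (hφ : ∀ x : A.endAlgebra, (∀ y : K, Commute x (φ y)) → x ∈ Set.range φ)
    {m : ℕ} (hm : A.dim = Module.finrank ℚ K * m) (hodd : Odd m) (N : ℕ) :
    HodgeConjectureFor (A.powSucc N).dim (A.powSucc N).X :=
  hodgeConjectureFor_of_isDivisorGenerated (A.powSucc N)
    (isDivisorGenerated_powSucc_of_murty1988 h A hK φ hφ hm hodd N)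

/-- **Instance `N = 0`: the Hodge property of `A` itself**, modulo the fact.
[cite: Murty1988, Thm. 2 and §1 Remark 1] -/
theorem hodgeConjectureFor_self_of_murty1988
    (h : Murty1988_hodgeClasses_divisorial_powers_totallyRealMaxSubfield_oddHalfRank)
    (A : AbelianVariety ℂ) (hK : NumberField.IsTotallyReal K) (φ : K →+* A.endAlgebra)
    (hφ : ∀ x : A.endAlgebra, (∀ y : K, Commute x (φ y)) → x ∈ Set.range φ)
    {m : ℕ} (hm : A.dim = Module.finrank ℚ K * m) (hodd : Odd m) :
    HodgeConjectureFor A.dim A.X :=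
  hodgeConjectureFor_powSucc_of_murty1988 h A hK φ hφ hm hodd 0

/-! ### §3 The fact generalises Ribet's totally-real theorem (Murty p. 66: "a slight generalization of a result of Tankeev who proved it in the case `Δ(A) = E`") -/

/-- **Murty's Thm. 2 implies Ribet 1983 Thm. 1 (with Thm. 0), as rendered in the tree**: if `End⁰(A)` is itself
a totally real field `F` with `dim A = [F:ℚ]·r`, `r` odd, take `K = F` (carrier `EndField A hF`) and `φ` the
identity, which is trivially its own commutant. PROVED (the two renderings are compatible).
[cite: Murty1988, Thm. 2 and p. 66 L80–81] [cite: Ribet1983, Thms. 0 and 1] -/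
theorem ribet1983_totallyReal_of_murty1988
    (h : Murty1988_hodgeClasses_divisorial_powers_totallyRealMaxSubfield_oddHalfRank) :
    Ribet1983_hodgeClasses_divisorial_powers_totallyRealField_oddRelDim := by
  intro A hF hT r hr hodd N p c hc hpp
  refine h A (EndField A hF) hT (EndField.toEndAlgebra hF).toRingHom ?_ r ?_ hodd N p c hc hpp
  · intro x _
    exact ⟨(EndField.toEndAlgebra hF).symm x, (EndField.toEndAlgebra hF).apply_symm_apply x⟩
  · rw [Literature.AlgebraicGeometry.ComplexMultiplication.EndField.finrank_eq hF]
    exact hr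

/-! ### §4 The hypothesis of Thm. 2 as a predicate (definitions; nothing asserted) -/

/-- **`A` is of Murty type, witnessed by `(K, φ, m)`** — the hypothesis of Thm. 2 in the field case: `K` is a
totally real number field, `φ : K →+* End⁰(A)` embeds it as its own commutant (`φ(K)` is a maximal commutative
semisimple subalgebra, Murty's `E`), and `dim A = [K:ℚ]·m` with `m` odd (`H₁(A,ℚ)` is free over `K` of rank `2m`).
A definition (nothing asserted). [cite: Murty1988, Thm. 2 and §2 (p. 62)] -/
def IsMurtyTypeWith (A : AbelianVariety ℂ) (K : Type) [Field K] [NumberField K] (φ : K →+* A.endAlgebra)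
    (m : ℕ) : Prop :=
  NumberField.IsTotallyReal K ∧ (∀ x : A.endAlgebra, (∀ y : K, Commute x (φ y)) → x ∈ Set.range φ) ∧
    A.dim = Module.finrank ℚ K * m ∧ Odd m

/-- **`End⁰(A)` has a totally real self-commutant subfield of odd co-rank**: some packet `(K, φ, m)` as in
`IsMurtyTypeWith` exists (the class of abelian varieties Thm. 2 speaks about, field case). A definition (nothing
asserted). [cite: Murty1988, Thm. 2] -/
def HasTotallyRealOddMaxSubfield (A : AbelianVariety ℂ) : Prop :=
  ∃ (K : Type) (_ : Field K) (_ : NumberField K) (φ : K →+* A.endAlgebra) (m : ℕ), IsMurtyTypeWith A K φ m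

/-- A witnessed packet gives the predicate. [cite: Murty1988, Thm. 2] -/
theorem hasTotallyRealOddMaxSubfield_of_isMurtyTypeWith {A : AbelianVariety ℂ} {φ : K →+* A.endAlgebra} {m : ℕ}
    (hA : IsMurtyTypeWith A K φ m) : HasTotallyRealOddMaxSubfield A :=
  ⟨K, inferInstance, inferInstance, φ, m, hA⟩

/-- **The case `K = End⁰(A)` itself** (Tankeev / Ribet Thm. 1): if `End⁰(A)` is a totally real field `F` with
`dim A = [F:ℚ]·r`, `r` odd, then `(EndField A hF, id, r)` is a Murty packet (the identity is trivially its own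
commutant). [cite: Murty1988, Thm. 2 and p. 66 L80–81] [cite: Ribet1983, Thm. 1] -/
theorem isMurtyTypeWith_endField (A : AbelianVariety ℂ) (hF : IsField A.endAlgebra)
    (hT : NumberField.IsTotallyReal (EndField A hF)) {r : ℕ} (hr : A.dim = Module.finrank ℚ A.endAlgebra * r)
    (hodd : Odd r) : IsMurtyTypeWith A (EndField A hF) (EndField.toEndAlgebra hF).toRingHom r :=
  ⟨hT, fun x _ ↦ ⟨(EndField.toEndAlgebra hF).symm x, (EndField.toEndAlgebra hF).apply_symm_apply x⟩,
    by rw [Literature.AlgebraicGeometry.ComplexMultiplication.EndField.finrank_eq hF]; exact hr, hodd⟩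

/-- **`B = D` on every power, on the packet**, modulo the fact. [cite: Murty1988, Thm. 2] -/
theorem isDivisorGenerated_powSucc_of_isMurtyTypeWith
    (h : Murty1988_hodgeClasses_divisorial_powers_totallyRealMaxSubfield_oddHalfRank)
    {A : AbelianVariety ℂ} {φ : K →+* A.endAlgebra} {m : ℕ} (hA : IsMurtyTypeWith A K φ m) (N : ℕ) :
    IsDivisorGenerated (A.powSucc N) :=
  isDivisorGenerated_powSucc_of_murty1988 h A hA.1 φ hA.2.1 hA.2.2.1 hA.2.2.2 N

/-- **The Hodge property of every power, on the packet**, modulo the fact. [cite: Murty1988, Thm. 2 and §1 Remark 1] -/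
theorem hodgeConjectureFor_powSucc_of_isMurtyTypeWith
    (h : Murty1988_hodgeClasses_divisorial_powers_totallyRealMaxSubfield_oddHalfRank)
    {A : AbelianVariety ℂ} {φ : K →+* A.endAlgebra} {m : ℕ} (hA : IsMurtyTypeWith A K φ m) (N : ℕ) :
    HodgeConjectureFor (A.powSucc N).dim (A.powSucc N).X :=
  hodgeConjectureFor_powSucc_of_murty1988 h A hA.1 φ hA.2.1 hA.2.2.1 hA.2.2.2 N

/-- **The Hodge property of every power, on the predicate**, modulo the fact.
[cite: Murty1988, Thm. 2 and §1 Remark 1] -/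
theorem hodgeConjectureFor_powSucc_of_hasTotallyRealOddMaxSubfield
    (h : Murty1988_hodgeClasses_divisorial_powers_totallyRealMaxSubfield_oddHalfRank)
    {A : AbelianVariety ℂ} (hA : HasTotallyRealOddMaxSubfield A) (N : ℕ) :
    HodgeConjectureFor (A.powSucc N).dim (A.powSucc N).X := by
  obtain ⟨K, _, _, φ, m, hA⟩ := hA
  exact hodgeConjectureFor_powSucc_of_isMurtyTypeWith h hA N

end HodgeTheory

end Literature.AlgebraicGeometry.HodgeTheory

end
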